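import Summits.CriticalPhenomena.CardyFormulaZ2.Theorems.CardySelfDualSegmentUniformBoxCrossingDefs2
import Summits.CriticalPhenomena.CardyFormulaZ2.Theorems.CardySelfDualSegmentUniformBoxCrossingStubJoin
import HarnessLib

/-!
# Stub `stub_assembly`, part 1 (crux stmt-CriticalPhenomena-5476 `UniformBoxCrossing`, line `Sketch`):
# JOIN at `n = 32000 k`, `s = k` ⇒ the uniform hard-way bound `TBStatement` for every `n`

Bollobás–Riordan, *Percolation on self-dual polygon configurations* (2010, arXiv:1001.4674),
§5.1, end of the proof of Theorem 5.3 for the corner models `M_t = cornerPercolation t`: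
once the JOIN event `J(S₁, S₂)` of the two stacked squares `S₁ = [0, n]²`, `S₂ = S₁ + (0, s)`
(`joinEvent n s`, here with the constants `n = 32000 k`, `s = k` of line `Sketch`) has probability
`≥ c_J` uniformly in `t` and `k ≥ k₀`, the rectangle `[0, n] × [0, n + s]` is crossed the hard
way with probability `≥ c_J / 4` (Lemma 5.5 + Harris–FKG, the tree's
`quarter_le_real_lrCrossing_of_join` and `tbCrossing_of_join` of `…StubJoin.lean`, transposed back
by `cornerPercolation_real_tbCrossing`), and every width `n ≥ 32000 (k₀ + 64000)` is handled by
rounding `n` down to a multiple `n' = 32000 k` of `32000` and widening the rectangle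
(`tbCrossing n' h ⊆ tbCrossing n h` for `n' ≤ n`), with `K = 128000`.

* `measurableSet_joinEvent`, `isUpperSet_joinEvent` — bookkeeping for `joinEvent`.
* `quarter_le_real_tbCrossing_of_joinEvent` — `M_t(J(n, k)) ≥ c ⇒ M_t(TB([0,n] × [0,n+k])) ≥ c/4`.
* `tbCrossing_mono_left` — vertical crossings are monotone in the width.
* `TBOfJoinStatement` / `tbOfJoin_holds` — the registered glue: a uniform JOIN bound at
  `(32000 k, k)` gives `TBStatement`.
-/

noncomputable section

namespace Summit.CriticalPhenomena.CardyFormulaZ2.Cruxes.UniformBoxCrossing.NonSlantLine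

open MeasureTheory SimpleGraph Finset Literature.Probability.Percolation Literature.Probability.LatticeModels

/-- The JOIN event is measurable (a finite union over the endpoints of intersections of three
restricted connection events). [folklore] -/
theorem measurableSet_joinEvent (n k : ℕ) : MeasurableSet (joinEvent n k) := by
  refine measurableSet_setOf_exists_mem fun a₁ => measurableSet_setOf_exists_mem fun b₁ =>
    measurableSet_setOf_exists_mem fun a₂ => measurableSet_setOf_exists_mem fun b₂ => ?_
  exact (measurableSet_openConnIn_of_countable _ _ _).inter
    ((measurableSet_openConnIn_of_countable _ _ _).inter
      (measurableSet_openConnIn_of_countable _ _ _))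

/-- The JOIN event is increasing. [folklore] -/
theorem isUpperSet_joinEvent (n k : ℕ) : IsUpperSet (joinEvent n k) := by
  rintro ω ω' hle ⟨a₁, ha₁, b₁, hb₁, a₂, ha₂, b₂, hb₂, e₁, e₂, e₃⟩
  exact ⟨a₁, ha₁, b₁, hb₁, a₂, ha₂, b₂, hb₂, isUpperSet_openConnIn _ _ _ hle e₁,
    isUpperSet_openConnIn _ _ _ hle e₂, isUpperSet_openConnIn _ _ _ hle e₃⟩

/-- **JOIN ⇒ hard-way crossing** (Bollobás–Riordan 2010, Lemma 5.5 and the first display of the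
proof of Lemma 5.4, for `M_t`): `M_t(J(n, k)) ≥ c` implies `M_t(TB([0, n] × [0, n + k])) ≥ c / 4`
(crossings of a square meet, Harris–FKG, squares crossed with probability `≥ 1/2`).
[cite: BollobasRiordan2010, §5.1 Lemma 5.5] -/
theorem quarter_le_real_tbCrossing_of_joinEvent (t : unitInterval) {n k : ℕ} {c : ℝ}
    (hc : c ≤ (cornerPercolation t).real (joinEvent n k)) :
    c / 4 ≤ (cornerPercolation t).real (tbCrossing n (n + k)) := by
  rw [cornerPercolation_real_tbCrossing]
  refine quarter_le_real_lrCrossing_of_join t hc (isUpperSet_joinEvent n k)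
    (measurableSet_joinEvent n k) ?_
  rintro ω hω ⟨a₁, ha₁, b₁, hb₁, a₂, ha₂, b₂, hb₂, e₁, e₂, e₃⟩ hV₁ hV₂
  exact tbCrossing_of_join hω ha₁ hb₁ ha₂ hb₂ e₁ e₂ e₃ hV₁ hV₂

/-- Vertical crossings are monotone in the width: a top–bottom crossing of `[0, m] × [0, h]` is
one of `[0, m'] × [0, h]` for `m ≤ m'`. [folklore] -/
theorem tbCrossing_mono_left {m m' : ℕ} (h : m ≤ m') (hgt : ℕ) :
    tbCrossing m hgt ⊆ tbCrossing m' hgt := by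
  refine openCrossing_mono ?_ ?_ ?_
  · intro z hz
    rw [Finset.mem_coe, mem_rectangle_iff] at hz ⊢
    omega
  · intro z hz
    simp only [Finset.mem_coe, bottomSide, Finset.mem_filter, mem_rectangle_iff] at hz ⊢
    omega
  · intro z hz
    simp only [Finset.mem_coe, topSide, Finset.mem_filter, mem_rectangle_iff] at hz ⊢
    omega

/-- Probability form of `tbCrossing_mono_left`. [folklore] -/
theorem cornerPercolation_real_tbCrossing_mono_left (t : unitInterval) {m m' : ℕ} (h : m ≤ m')
    (hgt : ℕ) :
    (cornerPercolation t).real (tbCrossing m hgt) ≤ (cornerPercolation t).real (tbCrossing m' hgt) :=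
  measureReal_mono (tbCrossing_mono_left h hgt) (measure_ne_top _ _)

/-- Statement form of `tbOfJoin_holds` — "a JOIN bound `≥ c_J` at `(n, s) = (32000 k, k)`,
uniform in `t` and `k ≥ k₀`, gives the uniform hard-way bound `TBStatement`": a registered glue
step the LINE POSITS and proves right below; not a literature fact, never to be relocated. -/
def TBOfJoinStatement : Prop :=
  ∀ (cJ : ℝ), 0 < cJ → ∀ k₀ : ℕ,
    (∀ (t : unitInterval) (k : ℕ), k₀ ≤ k → 1 ≤ k →
      cJ ≤ (cornerPercolation t).real (joinEvent (32000 * k) k)) →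
    TBStatement

/-- **JOIN ⇒ the uniform hard-way bound for every width** (Bollobás–Riordan 2010, end of the
proof of Thm. 5.3, for `M_t`): with `c = c_J / 4`, `K = 128000`, `n₀ = 32000 (k₀ + 64000)`; for
`n ≥ n₀` write `n = 32000 k + r`, `r < 32000`, take the shift `k'' = k - r ≥ 1`, so that
`n + k'' = 32000 k + k` and `TB([0, 32000k] × [0, 32000k + k]) ⊆ TB([0, n] × [0, n + k''])`.
[cite: BollobasRiordan2010, §5.1 proof of Thm. 5.3] -/
theorem tbOfJoin_holds : TBOfJoinStatement := by
  intro cJ hcJ k₀ hJ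
  refine ⟨cJ / 4, by positivity, 128000, 32000 * (k₀ + 64000), fun t n hn => ?_⟩
  obtain ⟨k, r, hr, hnk⟩ : ∃ k r : ℕ, r < 32000 ∧ n = 32000 * k + r :=
    ⟨n / 32000, n % 32000, Nat.mod_lt _ (by norm_num), (Nat.div_add_mod n 32000).symm⟩
  have hk₀ : k₀ ≤ k := by omega
  have hk : 64000 ≤ k := by omega
  refine ⟨32000 * k + k - n, by omega, by omega, by omega, ?_⟩
  have h1 := quarter_le_real_tbCrossing_of_joinEvent t (hJ t k hk₀ (by omega))
  have hw : n + (32000 * k + k - n) = 32000 * k + k := by omega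
  rw [hw]
  exact h1.trans (cornerPercolation_real_tbCrossing_mono_left t (by omega) _)

end Summit.CriticalPhenomena.CardyFormulaZ2.Cruxes.UniformBoxCrossing.NonSlantLine

end
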